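import Mathlib
import Summits.MatrixMultiplication.MatrixMultiplication.Theorems.GradedDesignFamily.Negative.FlatCard
import Summits.MatrixMultiplication.MatrixMultiplication.Theorems.GradedDesignFamily.Negative.FlatCorank
import Summits.MatrixMultiplication.MatrixMultiplication.Theorems.GradedDesignFamily.Negative.FlatTPP

/-!
# Garbage confinement for the quadratic-extension cell: the whole S3 design lives on `O(q³/c)` cosets
# (crux `LevelGradedCohnUmans.GradedDesignFamily`, stmt-MatrixMultiplication-7610; negative side,
# line `quadratic-extension-level-one-cell`, lead c8)

The line's open design stub S3 (`stub_subfieldCell`) asks for finite sets `Y, Z ⊆ GL₂(K)`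
(`Q := |K| = q²`) of size `≥ c·Q^{3/2} = c q³`, level-one separated against the image
`H := φ(SL₂ k)` of an injective hom: for every target `z₀ ∈ Z` a frame function
`g ↦ Σ_u cf u (g·u)` reading `[a = 1 ∧ y = y' ∧ z = z₀]` at `φ(a)·y·y'⁻¹·z`.  Write
`Γ := {φ(a)·y·y'⁻¹·z : a ∈ SL₂ k, y ≠ y' ∈ Y, z ∈ Z} = H·(YY⁻¹∖1)·Z` for the GARBAGE (the words the
separators must kill), `h := |H|`, `m := |Z|`.

* `subfieldCell_confinement` —
  `|Γ| · (h m (Q²+Q−1) − 2Q⁴ + Q²) ≤ (Q³ + Q² − h m) · Q²(Q−1)(2Q−1)(Q+1)`.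
* `subfieldCell_garbage_card_ge` — `(|Y| − 1)·|Z| ≤ |Γ|`.

With `h = q³ − q` and `m = |Z| ≥ c q³` the first reads `|Γ| ≤ (2(1−c)/c + O(q⁻²))·q⁶`, i.e.
**the garbage — and with it `H·YY⁻¹·Z ⊇ H·Y·w` for every `w ∈ Y⁻¹Z` — occupies at most
`(2(1−c)/c + o(1))·q³` cosets of `H`** (out of `q(q⁴−1)`), while the second shows it occupies at least
`(|Y|−1)|Z|/|H| ≈ c² q³` of them.  As a pure size bound this only caps `c` at the root of
`c³ + 2c − 2` (`≈ 0.77`, weaker than the Neumann ceiling `1/2`, `subfieldCell_ceiling`); its content is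
CONFINEMENT: `|HY · Y⁻¹Z| ≤ (2/c³ + o(1))·|Y⁻¹Z|` although `|HY| = |H||Y|`, `|Y⁻¹Z| = |Y||Z|`
(`gl2Flat_tpp_of_separators`), so the right translates `π(Y)·w` (`w ∈ Y⁻¹Z`, `c²q⁶` of them) of the
`cq³`-set `π(Y) ⊆ H\G` pairwise overlap in a constant fraction on average: `Y⁻¹ZZ⁻¹Y` meets the
`O(1)`-approximate stabiliser `{g : |π(Y)g ∩ π(Y)| ≥ (c²/4)|Y|}` in a `c²/4`-fraction of its mass.
This is the input "L2" of the line's kill programme (`Cruxes/…/Lines/quadratic-extension-level-one-cell-c8.md`).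

PROOF.  `gl2Flat_corank_of_separators` gives a real space `W` of real frame functions vanishing on
`Γ` with `dim W ≥ h m` (the real parts of the left `H`-translates of the separators restrict to a
permutation matrix on `H·Z`); `gl2Flat_card_le` (the flat-size lemma on `G`: Gram trace–rank + Bessel
for the `Q+1` orthogonal partitions `x ↦ x·u` of `M₂(K)`) gives
`|Γ|(Q⁵ − ρ(Q²+Q−1)) ≤ ρ Q²(Q−1)(2Q−1)(Q+1)` with `ρ = Q³+Q²−dim W ≤ Q³+Q²−hm`, monotone in `ρ`.
The lower bound: `(y', z) ↦ y₀ y'⁻¹ z` is injective on `(Y∖y₀) × Z` by the triple product property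
hidden in the separation clause (`gl2Flat_tpp_of_separators`).

Sorry-free; axioms `propext`, `Classical.choice`, `Quot.sound`.
-/

set_option linter.dupNamespace false

open scoped BigOperators

namespace Summit.MatrixMultiplication.MatrixMultiplication.Theorems.GradedDesignFamily.Negative

/-- **Garbage confinement for the quadratic-extension cell.**  Under S3's separation clause
(verbatim) for an injective `φ : SL₂(k) →* GL₂(K)` and nonempty `Y`, the garbage set
`Γ = {φ(a)·y·y'⁻¹·z : y ≠ y'}` satisfies
`|Γ|·(h m (Q²+Q−1) − 2Q⁴ + Q²) ≤ (Q³+Q²−hm)·Q²(Q−1)(2Q−1)(Q+1)` with `Q = |K|`, `h = |φ(SL₂ k)|`,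
`m = |Z|`: for `|K| = |k|²` and `|Z| ≥ c|k|³` the garbage fits into `(2(1−c)/c + o(1))·|k|³` cosets of
`φ(SL₂ k)`. -/
theorem subfieldCell_confinement {k K : Type} [Field k] [Fintype k] [DecidableEq k] [Field K]
    [Fintype K] [DecidableEq K]
    (φ : Matrix.SpecialLinearGroup (Fin 2) k →* Matrix.GeneralLinearGroup (Fin 2) K)
    (hφ : Function.Injective φ) (Y Z : Finset (Matrix.GeneralLinearGroup (Fin 2) K))
    (hY : Y.Nonempty)
    (hsep : ∀ z₀ ∈ Z, ∃ cf : (Fin 2 → K) → (Fin 2 → K) → ℂ,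
      ∀ a : Matrix.SpecialLinearGroup (Fin 2) k, ∀ y ∈ Y, ∀ y' ∈ Y, ∀ z ∈ Z,
        (∑ u : Fin 2 → K, cf u (((φ a * y * y'⁻¹ * z : Matrix.GeneralLinearGroup (Fin 2) K) :
            Matrix (Fin 2) (Fin 2) K).mulVec u)) =
          if a = 1 ∧ y = y' ∧ z = z₀ then 1 else 0) :
    (((((Finset.univ : Finset (Matrix.SpecialLinearGroup (Fin 2) k)) ×ˢ Y ×ˢ Y ×ˢ Z).filter
          fun t => t.2.1 ≠ t.2.2.1).image
        fun t => φ t.1 * t.2.1 * (t.2.2.1)⁻¹ * t.2.2.2).card : ℝ) *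
        (((Finset.univ.image φ).card : ℝ) * Z.card *
            ((Fintype.card K : ℝ) ^ 2 + Fintype.card K - 1) -
          2 * (Fintype.card K : ℝ) ^ 4 + (Fintype.card K : ℝ) ^ 2) ≤
      ((Fintype.card K : ℝ) ^ 3 + (Fintype.card K : ℝ) ^ 2 -
          ((Finset.univ.image φ).card : ℝ) * Z.card) *
        (Fintype.card K : ℝ) ^ 2 * ((Fintype.card K : ℝ) - 1) * (2 * (Fintype.card K : ℝ) - 1) *
          ((Fintype.card K : ℝ) + 1) := by
  set Γ := (((Finset.univ : Finset (Matrix.SpecialLinearGroup (Fin 2) k)) ×ˢ Y ×ˢ Y ×ˢ Z).filter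
      fun t => t.2.1 ≠ t.2.2.1).image fun t => φ t.1 * t.2.1 * (t.2.2.1)⁻¹ * t.2.2.2 with hΓdef
  -- every element of `Γ` is a garbage word
  have hΓ : ∀ x ∈ Γ, ∃ a : Matrix.SpecialLinearGroup (Fin 2) k, ∃ y ∈ Y, ∃ y' ∈ Y, ∃ z ∈ Z,
      y ≠ y' ∧ x = φ a * y * y'⁻¹ * z := by
    intro x hx
    rw [hΓdef, Finset.mem_image] at hx
    obtain ⟨t, ht, rfl⟩ := hx
    rw [Finset.mem_filter] at ht
    obtain ⟨ht, hne⟩ := ht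
    simp only [Finset.mem_product, Finset.mem_univ, true_and] at ht
    exact ⟨t.1, t.2.1, ht.1, t.2.2.1, ht.2.1, t.2.2.2, ht.2.2, hne, rfl⟩
  -- the corank space and the flat-size lemma
  obtain ⟨W, hW, hvan, hdim⟩ := gl2Flat_corank_of_separators φ hφ Y Z hY hsep Γ hΓ
  have hflat := gl2Flat_card_le Γ W hW hvan
  -- arithmetic: monotonicity in `ρ`
  set Q : ℝ := (Fintype.card K : ℝ) with hQdef
  set n : ℝ := (Γ.card : ℝ) with hndef
  set hm : ℝ := ((Finset.univ.image φ).card : ℝ) * Z.card with hhmdef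
  have hQ1 : (1 : ℝ) ≤ Q := by rw [hQdef]; exact_mod_cast Fintype.card_pos
  have hle : hm ≤ (Module.finrank ℝ W : ℝ) := by
    rw [hhmdef]; exact_mod_cast hdim
  have hn : (0 : ℝ) ≤ n := by rw [hndef]; positivity
  have hM : (0 : ℝ) ≤ Q ^ 2 + Q - 1 := by nlinarith
  have hN : (0 : ℝ) ≤ Q ^ 2 * (Q - 1) * (2 * Q - 1) * (Q + 1) := by
    have h1 : (0 : ℝ) ≤ Q - 1 := by linarith
    have h2 : (0 : ℝ) ≤ 2 * Q - 1 := by linarith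
    positivity
  -- `hflat : n (Q⁵ − ρ_W M) ≤ ρ_W Q²(Q−1)(2Q−1)(Q+1)` with `ρ_W = Q³+Q²−dim W ≤ Q³+Q²−hm`
  have key : n * (Q ^ 5 - (Q ^ 3 + Q ^ 2 - hm) * (Q ^ 2 + Q - 1)) ≤
      (Q ^ 3 + Q ^ 2 - hm) * (Q ^ 2 * (Q - 1) * (2 * Q - 1) * (Q + 1)) := by
    have hρ : (Q ^ 3 + Q ^ 2 - (Module.finrank ℝ W : ℝ)) ≤ Q ^ 3 + Q ^ 2 - hm := by linarith
    have e1 : (Q ^ 3 + Q ^ 2 - (Module.finrank ℝ W : ℝ)) * Q ^ 2 * (Q - 1) * (2 * Q - 1) * (Q + 1) =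
        (Q ^ 3 + Q ^ 2 - (Module.finrank ℝ W : ℝ)) * (Q ^ 2 * (Q - 1) * (2 * Q - 1) * (Q + 1)) := by
      ring
    rw [e1] at hflat
    calc n * (Q ^ 5 - (Q ^ 3 + Q ^ 2 - hm) * (Q ^ 2 + Q - 1))
        ≤ n * (Q ^ 5 - (Q ^ 3 + Q ^ 2 - (Module.finrank ℝ W : ℝ)) * (Q ^ 2 + Q - 1)) := by
          apply mul_le_mul_of_nonneg_left _ hn
          nlinarith [mul_le_mul_of_nonneg_right hρ hM]
      _ ≤ (Q ^ 3 + Q ^ 2 - (Module.finrank ℝ W : ℝ)) * (Q ^ 2 * (Q - 1) * (2 * Q - 1) * (Q + 1)) :=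
          hflat
      _ ≤ (Q ^ 3 + Q ^ 2 - hm) * (Q ^ 2 * (Q - 1) * (2 * Q - 1) * (Q + 1)) :=
          mul_le_mul_of_nonneg_right hρ hN
  have e2 : Q ^ 5 - (Q ^ 3 + Q ^ 2 - hm) * (Q ^ 2 + Q - 1) =
      hm * (Q ^ 2 + Q - 1) - 2 * Q ^ 4 + Q ^ 2 := by ring
  have e3 : (Q ^ 3 + Q ^ 2 - hm) * (Q ^ 2 * (Q - 1) * (2 * Q - 1) * (Q + 1)) =
      (Q ^ 3 + Q ^ 2 - hm) * Q ^ 2 * (Q - 1) * (2 * Q - 1) * (Q + 1) := by ring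
  rw [e2, e3] at key
  rw [hhmdef] at key
  exact key

/-- **The garbage is not small either.**  Under S3's separation clause, for any `y₀ ∈ Y` the map
`(y', z) ↦ y₀·y'⁻¹·z = φ(1)·y₀·y'⁻¹·z` is injective on `(Y ∖ {y₀}) × Z` (triple product property,
`gl2Flat_tpp_of_separators`) and lands in the garbage, so `(|Y| − 1)·|Z| ≤ |Γ|`. -/
theorem subfieldCell_garbage_card_ge {k K : Type} [Field k] [Fintype k] [DecidableEq k] [Field K]
    [Fintype K] [DecidableEq K]
    (φ : Matrix.SpecialLinearGroup (Fin 2) k →* Matrix.GeneralLinearGroup (Fin 2) K)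
    (Y Z : Finset (Matrix.GeneralLinearGroup (Fin 2) K))
    (hsep : ∀ z₀ ∈ Z, ∃ cf : (Fin 2 → K) → (Fin 2 → K) → ℂ,
      ∀ a : Matrix.SpecialLinearGroup (Fin 2) k, ∀ y ∈ Y, ∀ y' ∈ Y, ∀ z ∈ Z,
        (∑ u : Fin 2 → K, cf u (((φ a * y * y'⁻¹ * z : Matrix.GeneralLinearGroup (Fin 2) K) :
            Matrix (Fin 2) (Fin 2) K).mulVec u)) =
          if a = 1 ∧ y = y' ∧ z = z₀ then 1 else 0) :
    (Y.card - 1) * Z.card ≤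
      ((((Finset.univ : Finset (Matrix.SpecialLinearGroup (Fin 2) k)) ×ˢ Y ×ˢ Y ×ˢ Z).filter
          fun t => t.2.1 ≠ t.2.2.1).image
        fun t => φ t.1 * t.2.1 * (t.2.2.1)⁻¹ * t.2.2.2).card := by
  rcases Y.eq_empty_or_nonempty with hYe | ⟨y₀, hy₀⟩
  · simp [hYe]
  have htpp := gl2Flat_tpp_of_separators φ Y Z hsep
  -- the injection `(y', z) ↦ y₀ y'⁻¹ z` on `(Y.erase y₀) ×ˢ Z`
  have hcard : ((Y.erase y₀) ×ˢ Z).card ≤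
      ((((Finset.univ : Finset (Matrix.SpecialLinearGroup (Fin 2) k)) ×ˢ Y ×ˢ Y ×ˢ Z).filter
          fun t => t.2.1 ≠ t.2.2.1).image
        fun t => φ t.1 * t.2.1 * (t.2.2.1)⁻¹ * t.2.2.2).card := by
    refine Finset.card_le_card_of_injOn (fun p => φ 1 * y₀ * p.1⁻¹ * p.2) (fun p hp => ?_)
      (fun p hp p' hp' h => ?_)
    · -- lands in the garbage
      rw [Finset.mem_coe, Finset.mem_product] at hp
      obtain ⟨hp1, hp2⟩ := hp
      rw [Finset.mem_erase] at hp1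
      rw [Finset.mem_coe, Finset.mem_image]
      refine ⟨(1, y₀, p.1, p.2), ?_, rfl⟩
      rw [Finset.mem_filter]
      refine ⟨?_, fun h => hp1.1 h.symm⟩
      simp only [Finset.mem_product, Finset.mem_univ, true_and]
      exact ⟨hy₀, hp1.2, hp2⟩
    · -- injective, by the triple product property
      rw [Finset.mem_coe, Finset.mem_product] at hp hp'
      obtain ⟨hp1, hp2⟩ := hp
      obtain ⟨hp1', hp2'⟩ := hp'
      rw [Finset.mem_erase] at hp1 hp1'
      -- `y₀ p.1⁻¹ p.2 = y₀ p'.1⁻¹ p'.2` ⟹ `φ 1 * p'.1 * p.1⁻¹ * p.2 = p'.2`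
      have h' : φ 1 * p'.1 * p.1⁻¹ * p.2 = p'.2 := by
        have h1 : φ 1 * y₀ * p.1⁻¹ * p.2 = φ 1 * y₀ * p'.1⁻¹ * p'.2 := h
        rw [map_one, one_mul] at h1
        have h2 : p.1⁻¹ * p.2 = p'.1⁻¹ * p'.2 := by
          have := congrArg (fun g => y₀⁻¹ * g) h1
          simpa only [← mul_assoc, inv_mul_cancel, one_mul] using this
        rw [map_one, one_mul, mul_assoc, h2, ← mul_assoc, mul_inv_cancel, one_mul]
      obtain ⟨-, hyy, hzz⟩ := htpp 1 p'.1 hp1'.2 p.1 hp1.2 p.2 hp2 p'.2 hp2' h'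
      exact Prod.ext hyy.symm hzz
  rw [Finset.card_product, Finset.card_erase_of_mem hy₀] at hcard
  exact hcard

end Summit.MatrixMultiplication.MatrixMultiplication.Theorems.GradedDesignFamily.Negative
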